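import Literature.Computability.AlgebraicComplexity.MS21ANFThm35HasseBranch
import Literature.Computability.AlgebraicComplexity.MS21ANFSecondDerivativeHitting
import HarnessLib

/-!
# Medini–Shpilka 2021, Thm 35 (`thm:pitRoanf`): the typed statement from Lemma 5.12 alone
# (characteristic `0` / `> 2^Δ`), and from Lemma 5.12 + the structure lemma (all fields)

With the Lemma 5.14/5.15 engine in the tree (seat t24 g5,
`MS2021.bind₁_affSubst_sum_C_mul_pderiv_pderiv_anf_ne_zero`, `MS21ANFSecondDerivativeHitting`) the
hypothesis `hL2D` of the core assemblies `MS21ANFThm35CoreAssembly` / `MS21ANFThm35HasseBranch` is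
discharged verbatim.  What remains of the typed literature statement `MS2021_thm_35`
(`MS21DenseOrbitsHittingSets`) is therefore:

* for a field `K` with `(m : K) ≠ 0` for `1 ≤ m ≤ 2^Δ` (characteristic `0`, or characteristic
  `> 2^Δ`) and `Δ₁ = Δ₂ = Δ`: ONLY Lemma 5.12 (`lem:roanfMonInc`) in the TR-free form `h512`
  (`MS2021_thm_35_sameDepth_of_h512_of_cast_ne_zero`, `…_of_charZero`, `…_of_lt_ringChar`) — Lemma 5.13
  is the tree's `MS2021.exists_pderiv_pderiv_anf_separates_linSubst` (seat p1 g5);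
* for ALL fields: Lemma 5.12 (`h512`) and the disjunctive separation brick `h513H` (contrapositive of
  the characteristic-free structure lemma replacing Lemma 5.13, registry B36, seat t18)
  (`MS2021_thm_35_of_h512_h513H`);
* `Δ₁ ≠ Δ₂` is unconditional (`MS2021_thm_35_of_ne`, `MS21ANFOrbitsDistinctDepthProofs`).

Theorems only (no definitions, no new named facts, D-0026).  HONEST FRAMING: `MS2021_thm_35` is NOT
discharged here — `h512` (Lemma 5.12, in flight, seats p1 g5 / t24 g5) and, for small positive
characteristic, `h513H` (in flight, seat t18) remain hypotheses.  `VP ≠ VNP` is NOT proved and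
nothing in this file bears on it.

## References
* [MediniShpilka2021] D. Medini, A. Shpilka, CCC 2021 (LIPIcs 200:19) = arXiv:2102.05632: Thm 35
  (CCC p.19:13; arXiv p0008:L29–30) and its proof §5.2 (p0030:L28–p0031:L24); Lemma 5.12
  (p0027:L32–p0028), Lemma 5.13 (p0029:L3–L13), Lemmas 5.14–5.15 (p0029:L14–p0030:L26).
-/

noncomputable section

open MvPolynomial
open scoped Matrix

namespace Literature.Computability.AlgebraicComplexity

open MS2021

/-- **MS Thm 35 at `(K, Δ, Δ)` from Lemma 5.12 alone, when `1, …, 2^Δ` are nonzero in `K`.**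
[cite: MediniShpilka2021, Thm 35 (CCC p.19:13; arXiv p0008:L29-30); proof §5.2 (arXiv p0030:L28–p0031:L24)] -/
theorem MS2021_thm_35_sameDepth_of_h512_of_cast_ne_zero (K : Type) [Field K] (Δ : ℕ)
    (hK : ∀ m : ℕ, 1 ≤ m → m ≤ 2 ^ Δ → (m : K) ≠ 0)
    (h512 : ∀ (M : Matrix (Fin (4 ^ Δ)) (Fin (4 ^ Δ)) K), IsUnit M.det →
      (affSubst le_rfl M 0 (anf K Δ)).support ⊆ (anf K Δ).support →
      ∃ (π : Equiv.Perm (Fin (4 ^ Δ))) (α : Fin (4 ^ Δ) → K), (∀ i, α i ≠ 0) ∧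
        rename π (anf K Δ) = anf K Δ ∧
        affSubst le_rfl M 0 (anf K Δ) = aeval (fun i => C (α i) * X (π i)) (anf K Δ))
    (n c : ℕ) :
    ∀ f₁ ∈ affOrbit n (anf K Δ), ∀ f₂ ∈ affOrbit n (anf K Δ), f₁ - f₂ ≠ 0 →
      ∀ G : Fin n → MvPolynomial (Fin (2 * max Δ Δ + 7) × (Fin c ⊕ Unit)) K,
        IsIndependent (2 * max Δ Δ + 7) G → IsUniform G → bind₁ G (f₁ - f₂) ≠ 0 :=
  MS2021_thm_35_sameDepth_of_bricks_of_cast_ne_zero K Δ hK h512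
    (fun _ _ _ _ α hα h _ hA b ht G hG hB =>
      bind₁_affSubst_sum_C_mul_pderiv_pderiv_anf_ne_zero α hα h hA b ht G hG hB) n c

/-- Characteristic `0` instance of `MS2021_thm_35_sameDepth_of_h512_of_cast_ne_zero`.
[cite: MediniShpilka2021, Thm 35 (CCC p.19:13; arXiv p0008:L29-30)] -/
theorem MS2021_thm_35_sameDepth_of_h512_of_charZero (K : Type) [Field K] [CharZero K] (Δ : ℕ)
    (h512 : ∀ (M : Matrix (Fin (4 ^ Δ)) (Fin (4 ^ Δ)) K), IsUnit M.det →
      (affSubst le_rfl M 0 (anf K Δ)).support ⊆ (anf K Δ).support →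
      ∃ (π : Equiv.Perm (Fin (4 ^ Δ))) (α : Fin (4 ^ Δ) → K), (∀ i, α i ≠ 0) ∧
        rename π (anf K Δ) = anf K Δ ∧
        affSubst le_rfl M 0 (anf K Δ) = aeval (fun i => C (α i) * X (π i)) (anf K Δ))
    (n c : ℕ) :
    ∀ f₁ ∈ affOrbit n (anf K Δ), ∀ f₂ ∈ affOrbit n (anf K Δ), f₁ - f₂ ≠ 0 →
      ∀ G : Fin n → MvPolynomial (Fin (2 * max Δ Δ + 7) × (Fin c ⊕ Unit)) K,
        IsIndependent (2 * max Δ Δ + 7) G → IsUniform G → bind₁ G (f₁ - f₂) ≠ 0 :=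
  MS2021_thm_35_sameDepth_of_h512_of_cast_ne_zero K Δ
    (fun m hm _ => by exact_mod_cast (by omega : m ≠ 0)) h512 n c

/-- Large positive characteristic instance (`char K > 2^Δ`) of
`MS2021_thm_35_sameDepth_of_h512_of_cast_ne_zero`. [cite: MediniShpilka2021, Thm 35 (CCC p.19:13; arXiv p0008:L29-30)] -/
theorem MS2021_thm_35_sameDepth_of_h512_of_lt_ringChar (K : Type) [Field K] (Δ : ℕ)
    (hp : 2 ^ Δ < ringChar K)
    (h512 : ∀ (M : Matrix (Fin (4 ^ Δ)) (Fin (4 ^ Δ)) K), IsUnit M.det →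
      (affSubst le_rfl M 0 (anf K Δ)).support ⊆ (anf K Δ).support →
      ∃ (π : Equiv.Perm (Fin (4 ^ Δ))) (α : Fin (4 ^ Δ) → K), (∀ i, α i ≠ 0) ∧
        rename π (anf K Δ) = anf K Δ ∧
        affSubst le_rfl M 0 (anf K Δ) = aeval (fun i => C (α i) * X (π i)) (anf K Δ))
    (n c : ℕ) :
    ∀ f₁ ∈ affOrbit n (anf K Δ), ∀ f₂ ∈ affOrbit n (anf K Δ), f₁ - f₂ ≠ 0 →
      ∀ G : Fin n → MvPolynomial (Fin (2 * max Δ Δ + 7) × (Fin c ⊕ Unit)) K,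
        IsIndependent (2 * max Δ Δ + 7) G → IsUniform G → bind₁ G (f₁ - f₂) ≠ 0 := by
  refine MS2021_thm_35_sameDepth_of_h512_of_cast_ne_zero K Δ (fun m hm hmle h0 => ?_) h512 n c
  have hdvd := (ringChar.spec K m).1 h0
  have := Nat.le_of_dvd (by omega) hdvd
  omega

/-- **MS Thm 35 (all fields, all depths) from Lemma 5.12 and the disjunctive (Hasse) separation
brick for every field and depth** — the Lemma 5.14/5.15 engine is discharged by the tree.
[cite: MediniShpilka2021, Thm 35 (CCC p.19:13; arXiv p0008:L29-30); proof §5.2 (arXiv p0030:L28–p0031:L24)] -/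
theorem MS2021_thm_35_of_h512_h513H
    (h512 : ∀ (K : Type) [Field K] (Δ : ℕ) (M : Matrix (Fin (4 ^ Δ)) (Fin (4 ^ Δ)) K),
      IsUnit M.det → (affSubst le_rfl M 0 (anf K Δ)).support ⊆ (anf K Δ).support →
      ∃ (π : Equiv.Perm (Fin (4 ^ Δ))) (α : Fin (4 ^ Δ) → K), (∀ i, α i ≠ 0) ∧
        rename π (anf K Δ) = anf K Δ ∧
        affSubst le_rfl M 0 (anf K Δ) = aeval (fun i => C (α i) * X (π i)) (anf K Δ))
    (h513H : ∀ (K : Type) [Field K] (Δ : ℕ) (M : Matrix (Fin (4 ^ Δ)) (Fin (4 ^ Δ)) K),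
      IsUnit M.det → ¬ (affSubst le_rfl M 0 (anf K Δ)).support ⊆ (anf K Δ).support →
      (∃ i j, pderiv i (pderiv j (anf K Δ)) = 0 ∧
        pderiv i (pderiv j (affSubst le_rfl M 0 (anf K Δ))) ≠ 0) ∨
      (∃ k, hasseD 2 (Pi.single k 1) (affSubst le_rfl M 0 (anf K Δ)) ≠ 0)) :
    MS2021_thm_35 :=
  MS2021_thm_35_of_bricks_hasse h512 h513H
    (fun _ _ _ _ _ _ _ α hα h _ hA b ht G hG hB =>
      bind₁_affSubst_sum_C_mul_pderiv_pderiv_anf_ne_zero α hα h hA b ht G hG hB)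

end Literature.Computability.AlgebraicComplexity

end
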